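import Summits.FinalStateConjecture.FinalStateConjecture.Theorems.SoloBlindTransport
import Summits.FinalStateConjecture.FinalStateConjecture.Theorems.SoloBlindPush
import Summits.FinalStateConjecture.FinalStateConjecture.Theorems.SoloBlindMinkowski
import Summits.FinalStateConjecture.FinalStateConjecture.Theorems.SoloBlindGenericity
import Literature.Geometry.Lorentzian.LeviCivitaProofs
import Literature.Geometry.Lorentzian.CompleteDevelopmentMaximal

/-!
# Solo (blind) — the conclusion of the final state conjecture is an isometry invariant

Every clause of the conclusion of `FinalStateConjecture` for one development `𝒟`
(`SoloBlindConclusion 𝒟 k`: complete future null infinity; an `N`-black-hole final state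
decomposition on the exterior `J⁺(Σ) ∩ I⁻(charted)` into subextremal Kerrs with the rays /
exhaustion / orientation clauses) is carried along an isometry of Cauchy developments
`ψ : M₁ ≃ M₂`, `ψ^* g₂ = g₁`, time-orientation preserving, `ψ ∘ ι₁ = ι₂`
(`SoloBlindIsometry.conclusion`, `soloBlind_conclusion_iff_of_isIsometricTo`), using the
transport theorems of `SoloBlindTransport` (rays, null infinity, causal sets) and
`SoloBlindPush` (decompositions, exhaustion, orientation).

Consequences.

* `soloBlind_settles_iff_exists` — since any two maximal globally hyperbolic vacuum developments
  of the same data are isometric (`mghd_unique_cauchy`, Choquet-Bruhat–Geroch 1969, Thm. 3), the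
  pointwise property `SoloBlindSettles X D` of the statement ("an MGHD exists AND EVERY MGHD has
  complete `𝓘⁺` and settles down") is equivalent to "SOME MGHD has complete `𝓘⁺` and settles
  down"; `soloBlind_statement_iff_exists` rewrites the summit accordingly. Unconditional.
* `soloBlind_trivialData_conclusion_of_isMaximal` — **rung 0 in full, unconditionally**: EVERY
  maximal vacuum Cauchy development of the trivial datum `(ℝ³, δ, 0)` has complete future null
  infinity and settles down to the trivial final state with all clauses of the statement
  (Minkowski space does, `soloBlind_minkowski_conclusion`; every MGHD of the trivial datum is
  isometric to it, `Minkowski.isIsometricTo_vacuumCauchyDevelopment_of_isMaximal`);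
  `soloBlind_settles_trivialData` — given the Choquet-Bruhat–Geroch existence theorem (named fact
  `choquetBruhat_geroch_exists_mghd_cauchy`, used only to have one maximal development), the
  trivial datum has the pointwise final-state property of the statement.
* `soloBlind_hasCompleteNullInfinity_iff_of_isIsometricTo` — the named fact
  `Development.hasCompleteFutureNullInfinity_iff_of_isIsometricTo` as a theorem for Cauchy
  developments.

References: Y. Choquet-Bruhat, R. Geroch, Comm. Math. Phys. 14 (1969) 329–335, Thm. 3;
B. O'Neill, *Semi-Riemannian geometry*, Academic Press 1983, Ch. 3, pp. 58, 90–91, Ch. 5,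
p. 145, Ch. 14, pp. 402–403; J. Sbierski, Ann. Henri Poincaré 17 (2016) 301–329, §2 (the
isometry class of a GHD is the solution); D. Christodoulou, Class. Quantum Grav. 16 (1999) A23,
pp. A26–A27.
-/

noncomputable section

open Literature.Geometry.Lorentzian TopologicalSpace Manifold Filter Topology Set Function
open scoped ContDiff Topology ENNReal Manifold

namespace Summit.FinalStateConjecture.FinalStateConjecture.Theorems

/-! ### E. The conclusion of the statement is an isometry invariant of developments -/

section Statement

variable {X : Type} [TopologicalSpace X] [ChartedSpace E3 X] [IsManifold (𝓡 3) ∞ X]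
  [ConnectedSpace X] {D : InitialDataSet (𝓡 3) X}

/-- **The conclusion of the final state conjecture for one development** `𝒟` (regularity `k`):
complete future null infinity, and an `N`-black-hole final state decomposition of the exterior
`O = J⁺(Σ) ∩ I⁻(charted)` into subextremal Kerrs with the rays / exhaustion / orientation
clauses — verbatim the consequent of `SoloBlindSettles` (there with `k = 2`). -/
def SoloBlindConclusion (𝒟 : CauchyDevelopment D) (k : ℕ) : Prop :=
  HasCompleteNullInfinity 𝒟 ∧
    ∃ (O : Set 𝒟.carrier) (d : FinalStateDecomposition 𝒟.toSpacetime O k),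
      (∀ i, Kerr.IsSubextremal (d.mass i) (d.spin i)) ∧ O = exteriorOf 𝒟 d.charted ∧
        RaysStayInClosure 𝒟 O ∧ HasExhaustiveCharts d ∧ IsFutureOriented d

namespace SoloBlindIsometry

variable {𝒟₁ 𝒟₂ : CauchyDevelopment D}
  (Ψ : SoloBlindIsometry 𝒟₁.toDataEmbedding 𝒟₂.toDataEmbedding)

/-- The isometric open embedding of spacetimes underlying an isometry of developments. -/
def toEmbedding : SoloBlindEmbedding 𝒟₁.toSpacetime 𝒟₂.toSpacetime where
  toFun := Ψ.toDiffeomorph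
  contMDiff := Ψ.toDiffeomorph.contMDiff
  isOpenEmbedding := by
    simpa only [Diffeomorph.coe_toHomeomorph] using Ψ.toDiffeomorph.toHomeomorph.isOpenEmbedding
  isIsometry := Ψ.isIsometry
  preserves := Ψ.preserves

/-- The underlying map of `toEmbedding` is `ψ`. -/
@[simp]
theorem toEmbedding_toFun : Ψ.toEmbedding.toFun = Ψ.toDiffeomorph := rfl

/-- `ψ(J⁺₁(Σ) ∩ I⁻₁(U)) = J⁺₂(Σ) ∩ I⁻₂(ψ U)`. -/
theorem image_exteriorOf (U : Set 𝒟₁.carrier) :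
    Ψ.toDiffeomorph '' exteriorOf 𝒟₁ U = exteriorOf 𝒟₂ (Ψ.toDiffeomorph '' U) := by
  unfold exteriorOf
  rw [image_inter Ψ.injective, Ψ.image_causalFuture, Ψ.image_chronologicalPast,
    ← Ψ.range_embed]

include Ψ in
/-- **`RaysStayInClosure` is transported**: a normalised null ray of `𝒟₂` from `p` pulls back
under `ψ⁻¹` to one of `𝒟₁` from `p`, which stays in `closure O`, and `ψ(closure O) =
closure (ψ O)`. -/
theorem raysStayInClosure_image {O : Set 𝒟₁.carrier} (h : RaysStayInClosure 𝒟₁ O) :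
    RaysStayInClosure 𝒟₂ (Ψ.toDiffeomorph '' O) := by
  intro _i₂ p γ dom hγ hdom t ht h0t
  haveI : 𝒟₁.metric.HasLeviCivita := 𝒟₁.metric.toPseudoRiemannianMetric.hasLeviCivita
  have h₁ := h p (Ψ.symm.toDiffeomorph ∘ γ) dom (Ψ.symm.isNormalisedNullRayFrom_comp hγ) hdom
    t ht h0t
  have hc : closure (Ψ.toDiffeomorph '' O) = Ψ.toDiffeomorph '' closure O := by
    rw [← Diffeomorph.coe_toHomeomorph, Homeomorph.image_closure]
  rw [hc, Ψ.mem_image_iff]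
  exact h₁

include Ψ in
/-- **Complete future null infinity is transported**
(`SoloBlindIsometry.hasCompleteFutureNullInfinity`; the Levi-Civita standing hypothesis of `𝒟₁`
holds outright, `PseudoRiemannianMetric.hasLeviCivita`). -/
theorem hasCompleteNullInfinity_of (h : HasCompleteNullInfinity 𝒟₁) :
    HasCompleteNullInfinity 𝒟₂ := by
  intro _i₂
  haveI : 𝒟₁.metric.HasLeviCivita := 𝒟₁.metric.toPseudoRiemannianMetric.hasLeviCivita
  exact Ψ.hasCompleteFutureNullInfinity h

include Ψ in
/-- **The whole conclusion is transported along an isometry of developments.** -/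
theorem conclusion {k : ℕ} (h : SoloBlindConclusion 𝒟₁ k) : SoloBlindConclusion 𝒟₂ k := by
  obtain ⟨hni, O, d, hsub, hO, hrays, hex, hfo⟩ := h
  refine ⟨Ψ.hasCompleteNullInfinity_of hni, Ψ.toEmbedding.toFun '' O, Ψ.toEmbedding.push d, hsub,
    ?_, Ψ.raysStayInClosure_image hrays, Ψ.toEmbedding.hasExhaustiveCharts_push hex,
    Ψ.toEmbedding.isFutureOriented_push hfo⟩
  rw [Ψ.toEmbedding.push_charted, toEmbedding_toFun, ← Ψ.image_exteriorOf, ← hO]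

end SoloBlindIsometry

/-- **Isometry invariance of the conclusion** (both directions). -/
theorem soloBlind_conclusion_iff_of_isIsometricTo {𝒟₁ 𝒟₂ : CauchyDevelopment D}
    (h : 𝒟₁.IsIsometricTo 𝒟₂) (k : ℕ) : SoloBlindConclusion 𝒟₁ k ↔ SoloBlindConclusion 𝒟₂ k :=
  ⟨(SoloBlindIsometry.ofIsIsometricTo h).conclusion,
    (SoloBlindIsometry.ofIsIsometricTo h).symm.conclusion⟩

/-- **The named fact `hasCompleteFutureNullInfinity_iff_of_isIsometricTo` as a theorem** for
Cauchy developments: completeness of `𝓘⁺` is an isometry invariant. Christodoulou, CQG 16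
(1999), pp. A26–A27. -/
theorem soloBlind_hasCompleteNullInfinity_iff_of_isIsometricTo {𝒟₁ 𝒟₂ : CauchyDevelopment D}
    (h : 𝒟₁.IsIsometricTo 𝒟₂) : HasCompleteNullInfinity 𝒟₁ ↔ HasCompleteNullInfinity 𝒟₂ :=
  ⟨(SoloBlindIsometry.ofIsIsometricTo h).hasCompleteNullInfinity_of,
    (SoloBlindIsometry.ofIsIsometricTo h).symm.hasCompleteNullInfinity_of⟩

variable [T2Space X] [SecondCountableTopology X]

/-- `SoloBlindSettles` unfolded with `SoloBlindConclusion`. -/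
theorem soloBlind_settles_iff_forall :
    SoloBlindSettles X D ↔ (∃ 𝒟 : VacuumCauchyDevelopment D, 𝒟.IsMaximal) ∧
      ∀ 𝒟 : VacuumCauchyDevelopment D, 𝒟.IsMaximal → SoloBlindConclusion 𝒟.toCauchyDevelopment 2 :=
  Iff.rfl

/-- **"Every MGHD settles" is "some MGHD settles".** Since any two maximal globally hyperbolic
vacuum developments of `D` are isometric (`mghd_unique_cauchy`, Choquet-Bruhat–Geroch 1969,
Thm. 3) and the conclusion is an isometry invariant (`soloBlind_conclusion_iff_of_isIsometricTo`),
the pointwise property of the statement is equivalent to the existence of ONE maximal vacuum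
Cauchy development with complete `𝓘⁺` which settles down. Unconditional. -/
theorem soloBlind_settles_iff_exists :
    SoloBlindSettles X D ↔
      ∃ 𝒟 : VacuumCauchyDevelopment D,
        𝒟.IsMaximal ∧ SoloBlindConclusion 𝒟.toCauchyDevelopment 2 := by
  constructor
  · rintro ⟨⟨𝒟, h𝒟⟩, h⟩
    exact ⟨𝒟, h𝒟, h 𝒟 h𝒟⟩
  · rintro ⟨𝒟, h𝒟, h⟩
    exact ⟨⟨𝒟, h𝒟⟩, fun 𝒟' h𝒟' ↦
      (soloBlind_conclusion_iff_of_isIsometricTo (mghd_unique_cauchy 𝒟 𝒟' h𝒟 h𝒟') 2).1 h⟩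

omit [T2Space X] [SecondCountableTopology X] in
/-- **Rung 0 in full, unconditionally: every maximal vacuum Cauchy development of the trivial
datum `(ℝ³, δ, 0)` has complete future null infinity and settles down** to the trivial final
state (`N = 0`, exterior `{x⁰ ≥ 0}`), with every clause of the statement: Minkowski space does
(`soloBlind_minkowski_conclusion`) and every MGHD of the trivial datum is isometric to it
(`Minkowski.isIsometricTo_vacuumCauchyDevelopment_of_isMaximal`, from the geodesic completeness
of Minkowski space). -/
theorem soloBlind_trivialData_conclusion_of_isMaximal (𝒟₀ : VacuumCauchyDevelopment trivialData)
    (h₀ : 𝒟₀.IsMaximal) : SoloBlindConclusion 𝒟₀.toCauchyDevelopment 2 :=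
  (soloBlind_conclusion_iff_of_isIsometricTo
    (Minkowski.isIsometricTo_vacuumCauchyDevelopment_of_isMaximal h₀) 2).1
    soloBlind_minkowski_conclusion

omit [T2Space X] [SecondCountableTopology X] in
/-- **The trivial datum has the pointwise final-state property of the statement**, given the
Choquet-Bruhat–Geroch existence theorem (named fact `choquetBruhat_geroch_exists_mghd_cauchy`,
used only to produce a maximal development; the settling of every maximal development is
unconditional, `soloBlind_trivialData_conclusion_of_isMaximal`). -/
theorem soloBlind_settles_trivialData (hcbg : choquetBruhat_geroch_exists_mghd_cauchy) :
    SoloBlindSettles Minkowski.slice trivialData :=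
  ⟨hcbg.exists_isMaximal_of_mem_admissibleVacuumData trivialData_mem_admissibleVacuumData,
    soloBlind_trivialData_conclusion_of_isMaximal⟩

end Statement

/-- **The summit, rewritten**: the final state conjecture says that for a tame-generic admissible
datum SOME maximal vacuum Cauchy development has complete `𝓘⁺` and settles down to finitely many
subextremal Kerrs (`soloBlind_statement_iff` and `soloBlind_settles_iff_exists`). -/
theorem soloBlind_statement_iff_exists :
    FinalStateConjecture ↔
      ∀ (X : Type) [TopologicalSpace X] [ChartedSpace E3 X] [IsManifold (𝓡 3) ∞ X] [T2Space X]
        [SecondCountableTopology X] [ConnectedSpace X],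
        InitialDataSet.IsTameChristodoulouGeneric (admissibleVacuumData X)
          (fun D ↦ ∃ 𝒟 : VacuumCauchyDevelopment D,
            𝒟.IsMaximal ∧ SoloBlindConclusion 𝒟.toCauchyDevelopment 2) 1 := by
  rw [soloBlind_statement_iff]
  have key : ∀ (X : Type) [TopologicalSpace X] [ChartedSpace E3 X] [IsManifold (𝓡 3) ∞ X]
      [T2Space X] [SecondCountableTopology X] [ConnectedSpace X],
      SoloBlindSettles X = fun D ↦ ∃ 𝒟 : VacuumCauchyDevelopment D,
        𝒟.IsMaximal ∧ SoloBlindConclusion 𝒟.toCauchyDevelopment 2 :=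
    fun X _ _ _ _ _ _ ↦ funext fun D ↦ propext soloBlind_settles_iff_exists
  simp only [key]

end Summit.FinalStateConjecture.FinalStateConjecture.Theorems

end
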